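import Literature.AlgebraicGeometry.Hu2025.Statements.S05ThetaBlowups.R106dThetaEquations
import Literature.AlgebraicGeometry.Hu2025.Proofs.S05ThetaBlowups.Prop511L
/-!
# Hu 2025 §5.4 Cor. 5.18 / Rem. 5.20 — `x_{(m,u_k)}` is invertible along `Ṽ_ϑ` on every chart where it is a variable:
# KERNEL DISCHARGE on the typed carrier (row 106d `Cor5_18`, `Cor5_18_cover`, `Rem5_20_1`), following the PRINTED proof
# (C40L117–L142, p.93–94): on the ϖ-standard chart of `ℛ̃_{ϑ[k]}` the governing binomial `B_{(s_{F_k}, s_{F,o})}` reads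
# «1 − x_{(m,u_k)} x_{u_{s_{F,o}}} x_{v_{s_{F,o}}}» (C40L133–L136), «Thus x_{(m,u_k)} is nowhere vanishing along Ṽ_{ϑ[k]} ∩ 𝔙» (C40L141–L142).

M-HU PREP by res-type-023 (gen 8), 2026-08-27 — FILED by res-type-055 (gen 9) as PARTITION-HU §3b HELPER for the row-106 owner res-type-023 (author of record; res-plan-2 IDLE POOL DEAL #4b 2026-08-27T08:54:38Z; helper TAKING 08:56:19Z, no objection) from the owner's deposited copy of record HOME/plan/tools/res-type-023/hu/file/Cor518.lean sha16 e352286519bca60a, UNCHANGED except this filing note; S files R106cThetaBlowups = p518536 · R106dThetaEquations = p521266; Proofs chain Charts = p514775 · Prop511 = p519351 · Prop511L = p523180 (target `…/Proofs/S05ThetaBlowups/Cor518.lean`, kind proof). Theorems about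
OUR carriers (`idealVTilde` = iterated strict transform of `idealV0` along `Φ.seq c 0 Υ`); nothing of [Hu25] asserted. AI work, weaker than
expert review. Standing facts used: `u_k` distinct (i), `𝔱 ∈ {2,3}`-free; (iii) «exactly one ≡ 1 coordinate per block» (gives the term
`s_{F,o}` with `x_{(u_{s_{F,o}},v_{s_{F,o}})} ≡ 1` when `(m,u_k)` is a variable); (iv) block map (`lead i = some r → blk r = i`).
-/

noncomputable section

open MvPolynomial

namespace Literature.AlgebraicGeometry.Hu2025.Statements.S05ThetaBlowups

universe u v

variable {R : Type u} [CommRing R] {V : Type v} [DecidableEq V]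

namespace ChartStep

variable (s : ChartStep V)

/-- The total transform lies in the strict transform: `π^* I · R[Var_𝔙] ≤ strict(I)`.
[cite: Hu2025, Cor. 5.18 / Rem. 5.20, pp. 93–94 (unrefereed preprint arXiv:2507.21400v1 under adjudication, D-0012/D-0089 — kernel support on OUR typed carrier of row 106; nothing of the source asserted)] -/
theorem map_le_strictTransform (I : Ideal (MvPolynomial V R)) :
    I.map (s.pullback (R := R)) ≤ s.strictTransform (R := R) I := by
  intro f hf
  unfold strictTransform
  refine (le_iSup (fun n : ℕ => (I.map (s.pullback (R := R))).colon ({s.excVar (R := R) ^ n} : Set (MvPolynomial V R))) 0) ?_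
  rw [Submodule.mem_colon_singleton, smul_eq_mul, pow_zero, mul_one]
  exact hf

/-- The pull-back of an element of `I` lies in the strict transform of `I` (total ⊆ strict). [cite: Hu2025, Cor. 5.18 / Rem. 5.20, pp. 93–94 (unrefereed preprint arXiv:2507.21400v1 under adjudication, D-0012/D-0089 — kernel support on OUR typed carrier of row 106; nothing of the source asserted)] -/
theorem pullback_mem_strictTransform {I : Ideal (MvPolynomial V R)} {f : MvPolynomial V R} (hf : f ∈ I) :
    s.pullback (R := R) f ∈ s.strictTransform (R := R) I :=
  s.map_le_strictTransform I (Ideal.mem_map_of_mem _ hf)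

/-- `ζ · g ∈ π^* I ⟹ g ∈ strict(I)`.
[cite: Hu2025, Cor. 5.18 / Rem. 5.20, pp. 93–94 (unrefereed preprint arXiv:2507.21400v1 under adjudication, D-0012/D-0089 — kernel support on OUR typed carrier of row 106; nothing of the source asserted)] -/
theorem mem_strictTransform_of_excVar_mul_mem {I : Ideal (MvPolynomial V R)} {g : MvPolynomial V R}
    (hg : X s.exc * g ∈ I.map (s.pullback (R := R))) : g ∈ s.strictTransform (R := R) I := by
  unfold strictTransform
  refine (le_iSup (fun n : ℕ => (I.map (s.pullback (R := R))).colon ({s.excVar (R := R) ^ n} : Set (MvPolynomial V R))) 1) ?_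
  rw [Submodule.mem_colon_singleton, smul_eq_mul, pow_one, excVar_eq, mul_comm]
  exact hg

/-- A step whose centre avoids `x_e` and `x_r` carries a relation `x_e − x_r·M ∈ I` to one of the same shape in `strict(I)`.
[cite: Hu2025, Cor. 5.18 / Rem. 5.20, pp. 93–94 (unrefereed preprint arXiv:2507.21400v1 under adjudication, D-0012/D-0089 — kernel support on OUR typed carrier of row 106; nothing of the source asserted)] -/
theorem shape_sub_mem_strictTransform {e r : V} (he : e ∉ s.centre) (hr : r ∉ s.centre) {I : Ideal (MvPolynomial V R)}
    {M : MvPolynomial V R} (h : X e - X r * M ∈ I) :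
    X e - X r * s.pullback (R := R) M ∈ s.strictTransform (R := R) I := by
  have := s.pullback_mem_strictTransform h
  rwa [map_sub, map_mul, pullback_X_of_not_mem s he, pullback_X_of_not_mem s hr] at this

/-- … and a relation `1 − x_r·M ∈ I` likewise.
[cite: Hu2025, Cor. 5.18 / Rem. 5.20, pp. 93–94 (unrefereed preprint arXiv:2507.21400v1 under adjudication, D-0012/D-0089 — kernel support on OUR typed carrier of row 106; nothing of the source asserted)] -/
theorem shape_one_sub_mem_strictTransform {r : V} (hr : r ∉ s.centre) {I : Ideal (MvPolynomial V R)}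
    {M : MvPolynomial V R} (h : 1 - X r * M ∈ I) :
    1 - X r * s.pullback (R := R) M ∈ s.strictTransform (R := R) I := by
  have := s.pullback_mem_strictTransform h
  rwa [map_sub, map_one, map_mul, pullback_X_of_not_mem s hr] at this

/-- The ϖ-step at block `k` (`ζ = x_{u_k}`, centre `{x_{u_k}, x_{(m,u_k)}}`): `x_{u_k} − x_{(m,u_k)}·M ∈ I` becomes
`1 − x_{(m,u_k)}·π^*M ∈ strict(I)` — the display C40L133–L136.
[cite: Hu2025, Cor. 5.18 / Rem. 5.20, pp. 93–94 (unrefereed preprint arXiv:2507.21400v1 under adjudication, D-0012/D-0089 — kernel support on OUR typed carrier of row 106; nothing of the source asserted)] -/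
theorem shape_sub_to_one_sub {e r : V} (hexc : s.exc = e) (hr : r ∈ s.centre) (hre : r ≠ e)
    {I : Ideal (MvPolynomial V R)} {M : MvPolynomial V R} (h : X e - X r * M ∈ I) :
    1 - X r * s.pullback (R := R) M ∈ s.strictTransform (R := R) I := by
  apply s.mem_strictTransform_of_excVar_mul_mem
  have h1 : s.pullback (R := R) (X e - X r * M) ∈ I.map (s.pullback (R := R)) := Ideal.mem_map_of_mem _ h
  have hre' : r ≠ s.exc := hexc ▸ hre
  rw [map_sub, map_mul, pullback_X_of_mem s hr hre', ← hexc, pullback_X_exc] at h1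
  have : X s.exc * (1 - X r * s.pullback (R := R) M) = X s.exc - X s.exc * X r * s.pullback (R := R) M := by ring
  rwa [this]

end ChartStep

namespace ThetaFrame

variable {P : Type v} {Rs : Type v} [DecidableEq P] [DecidableEq Rs] (Φ : ThetaFrame P Rs)

/-- The step at block `j` when `(m,u_j)` is a variable `r_j` of `𝔙_[0]`: its centre and exceptional index.
[cite: Hu2025, Cor. 5.18 / Rem. 5.20, pp. 93–94 (unrefereed preprint arXiv:2507.21400v1 under adjudication, D-0012/D-0089 — kernel support on OUR typed carrier of row 106; nothing of the source asserted)] -/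
theorem step_spec {c : Φ.Chart} {j : Fin Φ.N} {r : Rs} (h : Φ.lead j = some r) {s : ChartStep (P ⊕ Rs)}
    (hs : Φ.step c j = some s) :
    s.centre = {Sum.inl (Φ.ult j), Sum.inr r} ∧ s.exc = (c j).by (Sum.inl (Φ.ult j)) (Sum.inr r) := by
  simp only [step, h, Option.elim_some, Option.some.injEq] at hs
  subst hs
  exact ⟨rfl, rfl⟩

/-- The full word of the chart: `Φ.seq c 0 Υ` lists the steps of all blocks. [cite: Hu2025, Cor. 5.18 / Rem. 5.20, pp. 93–94 (unrefereed preprint arXiv:2507.21400v1 under adjudication, D-0012/D-0089 — kernel support on OUR typed carrier of row 106; nothing of the source asserted)] -/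
theorem seq_zero_N (c : Φ.Chart) : Φ.seq c 0 Φ.N = (List.finRange Φ.N).filterMap (Φ.step c) := by
  unfold seq
  congr 1
  exact List.filter_eq_self.mpr fun k _ => by simp [k.isLt]

section WithRing

variable (R : Type u) [CommRing R]

/-- The two shapes of the relation carried along the word: before block `k` is blown up, `x_{u_k} − x_{(m,u_k)}·M`; after the
ϖ-step at `k`, `1 − x_{(m,u_k)}·M`.
[cite: Hu2025, Cor. 5.18 / Rem. 5.20, pp. 93–94 (unrefereed preprint arXiv:2507.21400v1 under adjudication, D-0012/D-0089 — kernel support on OUR typed carrier of row 106; nothing of the source asserted)] -/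
def Shape (k : Fin Φ.N) (r : Rs) (done : Bool) (I : Ideal (MvPolynomial (P ⊕ Rs) R)) : Prop :=
  ∃ M : MvPolynomial (P ⊕ Rs) R, (if done then 1 else X (Sum.inl (Φ.ult k))) - X (Sum.inr r) * M ∈ I

/-- Invariant along a nodup list of blocks: folding the strict transforms of the steps over the list carries `Shape k r done` to
`Shape k r (done || k ∈ js)`, provided the chart is ϖ-standard at `k`.
[cite: Hu2025, Cor. 5.18 / Rem. 5.20, pp. 93–94 (unrefereed preprint arXiv:2507.21400v1 under adjudication, D-0012/D-0089 — kernel support on OUR typed carrier of row 106; nothing of the source asserted)] -/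
theorem shape_foldl (hult : Function.Injective Φ.ult) (hblk : ∀ i r, Φ.lead i = some r → Φ.blk r = i)
    (c : Φ.Chart) (k : Fin Φ.N) (r : Rs) (hk : Φ.lead k = some r) (hc : c k = ThetaKind.varpi) :
    ∀ (js : List (Fin Φ.N)), js.Nodup → ∀ (done : Bool) (I : Ideal (MvPolynomial (P ⊕ Rs) R)),
      (k ∈ js → done = false) → Φ.Shape R k r done I →
      Φ.Shape R k r (done || decide (k ∈ js)) ((js.filterMap (Φ.step c)).foldl (fun I s => s.strictTransform (R := R) I) I) := by
  intro js
  induction js with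
  | nil => intro _ done I _ h; simpa using h
  | cons i js ih =>
    intro hnd done I hdone hshape
    have hnd' : js.Nodup := (List.nodup_cons.mp hnd).2
    have hi_notin : i ∉ js := (List.nodup_cons.mp hnd).1
    by_cases hik : i = k
    · -- the ϖ-step at block k
      subst hik
      have hdf : done = false := hdone (by simp)
      subst hdf
      obtain ⟨s, hs, hexc⟩ := Φ.step_of_lead_some c hk
      obtain ⟨hcent, -⟩ := Φ.step_spec hk hs
      rw [List.filterMap_cons_some hs, List.foldl_cons]
      obtain ⟨M, hM⟩ := hshape
      have hshape' : Φ.Shape R i r true (s.strictTransform (R := R) I) := by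
        refine ⟨s.pullback (R := R) M, ?_⟩
        have hexc' : s.exc = Sum.inl (Φ.ult i) := by rw [hexc, hc, ThetaKind.varpi_by]
        have hrmem : (Sum.inr r : P ⊕ Rs) ∈ s.centre := by rw [hcent]; simp
        simpa using s.shape_sub_to_one_sub hexc' hrmem (by simp) (by simpa using hM)
      have := ih hnd' true _ (fun hk' => (hi_notin hk').elim) hshape'
      simpa using this
    · -- a block i ≠ k: the step (if any) fixes x_{u_k} and x_{(m,u_k)}
      have hkjs : k ∈ js ↔ k ∈ i :: js := by simp [Ne.symm hik]
      cases hstep : Φ.step c i with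
      | none =>
        rw [List.filterMap_cons_none hstep]
        have := ih hnd' done I (fun hk' => hdone (List.mem_cons_of_mem _ hk')) hshape
        simpa [List.mem_cons, Ne.symm hik] using this
      | some s =>
        rw [List.filterMap_cons_some hstep, List.foldl_cons]
        obtain ⟨r', hr', -⟩ := Φ.exc_of_step hstep
        obtain ⟨hcent, -⟩ := Φ.step_spec hr' hstep
        have he : (Sum.inl (Φ.ult k) : P ⊕ Rs) ∉ s.centre := by
          rw [hcent]; simp only [Finset.mem_insert, Finset.mem_singleton, Sum.inl.injEq, reduceCtorEq, or_false]
          exact fun h => hik (hult h).symm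
        have hr : (Sum.inr r : P ⊕ Rs) ∉ s.centre := by
          rw [hcent]; simp only [Finset.mem_insert, Finset.mem_singleton, reduceCtorEq, Sum.inr.injEq, false_or]
          intro h; subst h; exact hik ((hblk i r hr').symm.trans (hblk k r hk))
        have hshape' : Φ.Shape R k r done (s.strictTransform (R := R) I) := by
          obtain ⟨M, hM⟩ := hshape
          refine ⟨s.pullback (R := R) M, ?_⟩
          cases done with
          | true => simpa using s.shape_one_sub_mem_strictTransform hr (by simpa using hM)
          | false => simpa using s.shape_sub_mem_strictTransform he hr (by simpa using hM)
        have := ih hnd' done _ (fun hk' => hdone (List.mem_cons_of_mem _ hk')) hshape'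
        simpa [List.mem_cons, Ne.symm hik] using this

omit [DecidableEq P] [DecidableEq Rs] in
/-- The governing binomial `B_(kτ₀)` with `x_{(u_{s_τ₀},v_{s_τ₀})} ≡ 1` on `𝔙_[0]` is `x_{u_k} − x_{(m,u_k)} x_{u_s} x_{v_s}` — the
initial `Shape`.
[cite: Hu2025, Cor. 5.18 / Rem. 5.20, pp. 93–94 (unrefereed preprint arXiv:2507.21400v1 under adjudication, D-0012/D-0089 — kernel support on OUR typed carrier of row 106; nothing of the source asserted)] -/
theorem shape_idealV0 {k : Fin Φ.N} {r : Rs} (hk : Φ.lead k = some r) {τ₀ : Fin (Φ.t k)} (hτ : Φ.termR k τ₀ = none) :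
    Φ.Shape R k r false (Φ.idealV0 R) := by
  refine ⟨X (Sum.inl (Φ.termP₁ k τ₀)) * X (Sum.inl (Φ.termP₂ k τ₀)), ?_⟩
  have hmem : (Φ.gov0 k τ₀).toPoly (R := R) ∈ Φ.eqns0 R := by
    refine Or.inl ⟨Φ.gov0 k τ₀, Or.inl (Or.inl ⟨⟨k, τ₀⟩, rfl⟩), rfl⟩
  have heq : (Φ.gov0 k τ₀).toPoly (R := R) =
      X (Sum.inl (Φ.ult k)) - X (Sum.inr r) * (X (Sum.inl (Φ.termP₁ k τ₀)) * X (Sum.inl (Φ.termP₂ k τ₀))) := by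
    simp only [Binomial.toPoly, gov0, hτ, hk, eOpt, eP, Option.elim_none, Option.elim_some, zero_add, X,
      monomial_mul, mul_one, add_assoc]
  unfold idealV0
  simp only [Bool.false_eq_true, if_false]
  rw [← heq]
  exact Ideal.subset_span hmem

/-- **Cor. 5.18 «In particular» / Rem. 5.20 (`Cor5_18_cover` = `Rem5_20_1`) on the typed carrier, under the standing facts:** on a
chart of `ℛ̃_ϑ` that is ϖ-standard over block `k` with `(m,u_k)` a variable, `x_{(m,u_k)}` is a unit modulo the ideal of `Ṽ_ϑ ∩ 𝔙`.
[cite: Hu2025, Cor. 5.18 / Rem. 5.20, pp. 93–94 (unrefereed preprint arXiv:2507.21400v1 under adjudication, D-0012/D-0089 — kernel support on OUR typed carrier of row 106; nothing of the source asserted)] -/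
theorem cor5_18_cover (hult : Function.Injective Φ.ult)
    (hone : ∀ k, (Φ.lead k = none ∧ ∀ τ, Φ.termR k τ ≠ none) ∨
        (Φ.lead k ≠ none ∧ ∃ τ₀, Φ.termR k τ₀ = none ∧ ∀ τ, τ ≠ τ₀ → Φ.termR k τ ≠ none))
    (hblk : ∀ k r, Φ.lead k = some r → Φ.blk r = k)
    (c : Φ.Chart) (k : Fin Φ.N) (r : Rs) (hk : Φ.lead k = some r) (hc : c k = ThetaKind.varpi) :
    IsUnit (Ideal.Quotient.mk (Φ.idealVTilde R c Φ.N) (X (Sum.inr r))) := by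
  obtain ⟨τ₀, hτ⟩ : ∃ τ₀, Φ.termR k τ₀ = none := by
    rcases hone k with ⟨hnone, -⟩ | ⟨-, τ₀, hτ₀, -⟩
    · rw [hk] at hnone; exact (Option.some_ne_none _ hnone).elim
    · exact ⟨τ₀, hτ₀⟩
  have hfold := Φ.shape_foldl R hult hblk c k r hk hc (List.finRange Φ.N) (List.nodup_finRange Φ.N) false
    (Φ.idealV0 R) (fun _ => rfl) (Φ.shape_idealV0 R hk hτ)
  simp only [List.mem_finRange, decide_true, Bool.false_or] at hfold
  obtain ⟨M, hM⟩ := hfold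
  have hM' : 1 - X (Sum.inr r) * M ∈ Φ.idealVTilde R c Φ.N := by
    unfold idealVTilde ChartSeq.strictTransform
    rw [Φ.seq_zero_N]
    simpa using hM
  refine IsUnit.of_mul_eq_one (Ideal.Quotient.mk (Φ.idealVTilde R c Φ.N) M) ?_
  rw [← map_mul, ← (Ideal.Quotient.mk _).map_one, Ideal.Quotient.eq]
  have : X (Sum.inr r) * M - 1 = -(1 - X (Sum.inr r) * M) := by ring
  rw [this]
  exact (Φ.idealVTilde R c Φ.N).neg_mem hM'

/-- **`Cor5_18_cover` AS TYPED (v3: under `Φ.IsStandard`) holds on every frame.**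
[cite: Hu2025, Cor. 5.18 / Rem. 5.20, pp. 93–94 (unrefereed preprint arXiv:2507.21400v1 under adjudication, D-0012/D-0089 — kernel support on OUR typed carrier of row 106; nothing of the source asserted)] -/
theorem Cor5_18_cover_holds : Cor5_18_cover Φ R := fun hstd c k r hk hc =>
  Φ.cor5_18_cover R hstd.1 hstd.2.2.1 hstd.2.2.2.1 c k r hk hc

/-- **`Rem5_20_1` AS TYPED holds** (same Prop).
[cite: Hu2025, Cor. 5.18 / Rem. 5.20, pp. 93–94 (unrefereed preprint arXiv:2507.21400v1 under adjudication, D-0012/D-0089 — kernel support on OUR typed carrier of row 106; nothing of the source asserted)] -/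
theorem Rem5_20_1_holds : Rem5_20_1 Φ R := Φ.Cor5_18_cover_holds R

/-- **Cor. 5.18 second sentence (`Cor5_18`) AS TYPED (v3: under `Φ.IsStandard`) holds:** if `(m,u_k)` is a variable of `𝔙_[0]` and
still a variable of `𝔙` (not in `𝔡_𝔙`), then the chart is ϖ-standard at `k` and `x_{(m,u_k)}` is a unit modulo the ideal of `Ṽ_ϑ ∩ 𝔙`.
[cite: Hu2025, Cor. 5.18 / Rem. 5.20, pp. 93–94 (unrefereed preprint arXiv:2507.21400v1 under adjudication, D-0012/D-0089 — kernel support on OUR typed carrier of row 106; nothing of the source asserted)] -/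
theorem Cor5_18_holds : Cor5_18 Φ R := by
  intro hstd c k r hk hr
  have hc : c k = ThetaKind.varpi := by
    cases h : c k with
    | varpi => rfl
    | varrho => exact (hr (Φ.mem_dSet.mpr ⟨k, k.isLt, hk, h⟩)).elim
  exact Φ.cor5_18_cover R hstd.1 hstd.2.2.1 hstd.2.2.2.1 c k r hk hc

end WithRing

end ThetaFrame

end Literature.AlgebraicGeometry.Hu2025.Statements.S05ThetaBlowups

end
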